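import Literature.MathematicalPhysics.KineticTheory.HardSphereWindowPressureStatic
import Literature.MathematicalPhysics.KineticTheory.HardSphereDisplacementPathLength
import Summits.AtomisticToContinuum.HydrodynamicLimit.Theorems.AntiMazurCoboundariesInfluenceLocalityTrueCapsExistPrelimA
import Summits.AtomisticToContinuum.HydrodynamicLimit.Theorems.JParityClosureOddContactSymmetryGibbsInvariance

/-!
# Shot-noise pressure, static part: the close-pair count has pressure `o(N)` under the Gibbs law

Route `AntiMazurCoboundaries` of `AtomisticToContinuum/HydrodynamicLimit`, crux stmt-AtomisticToContinuum-14135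
(`CorrectorPressureDecay`), line `almost-invariant-duality`, lead-held layer-2 input h₂ = within-lag SHOT-NOISE
PRESSURE (hypothesis `h₂` of `TransferSkeleton.correctorPressureDecay_of_inputs`); registered sub-goal
`snp_static_of_pairsBound`.

Under the homogeneous hard-sphere Gibbs law `G_N` (`N + 1` spheres of diameter `ε_N = σ(N+1)^{-1/3}` on `𝕋³`,
`0 < σ ≤ 1/4`) the static close-pair count `S(z) = #{i | ∃ j ≠ i, dist(x_i, x_j) ≤ ε_N(1 + lam)}` satisfies
`∫ e^{cS} dG_N ≤ e^{ψ(N+1)}` (`c ≥ 0`, `ψ > 0`) once `lam ≤ lam₀(c, ψ, σ)` and `N + 1 ≥ 16/ψ²`, given the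
disjoint-close-pairs bound `(200σ³lam/(N+1))^m` (`snp_pairsBound`) and torus packing (`snp_packing`) as hypotheses.
Proof: a.e. in the hard-sphere domain every sphere has `≤ 124` close neighbours (packing); a maximum matching of
the close-pair graph has `≥ S/250` edges, so `{S ≥ k}` is covered by "the `m = ⌈k/250⌉` listed disjoint pairs are
close" over `≤ C(N+1, m)(N+1)^m` ordered families: `G_N{S ≥ k} ≤ (200σ³lam(N+1))^m/m!`. The tail sum
`e^{cS} ≤ e^{cα(N+1)} + ∑_{α(N+1) ≤ k ≤ N+1} e^{ck} 1{S ≥ k}` (`α = ψ/(2(c+1))`) then has summands of integral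
`≤ (e^{250c} · 200e · 250σ³lam/α)^m ≤ 1`, and `e^{ψ(N+1)/2} + N + 2 ≤ e^{ψ(N+1)}`.
-/

noncomputable section

open MeasureTheory Set Filter Topology
open scoped ENNReal Classical

namespace Summit.AtomisticToContinuum.HydrodynamicLimit.Theorems.ShotNoisePressure

open Literature.Analysis.FluidPDE
open Literature.MathematicalPhysics.KineticTheory (T3 V3 hsDiameter localGibbsLaw gaussMeasure)

/-- **Matchings in a bounded-degree graph.** For a symmetric relation `R` on `Fin n` with at most `Δ` neighbours
`j ≠ i` of every `i`, a set `A` of non-isolated vertices has `card A ≤ (2Δ + 2) t` for some `t` pairwise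
vertex-disjoint off-diagonal `R`-edges `(p k, q k)` with `p` strictly increasing (a maximum family of disjoint
edges meets every edge, so a non-isolated vertex is one of its `2t` vertices or adjacent to one). [folklore] -/
theorem exists_strictMono_matching {n Δ : ℕ} (R : Fin n → Fin n → Prop) (hsymm : ∀ i j, R i j → R j i)
    (hdeg : ∀ (i : Fin n) (B : Finset (Fin n)), (∀ j ∈ B, j ≠ i ∧ R i j) → B.card ≤ Δ)
    (A : Finset (Fin n)) (hA : ∀ i ∈ A, ∃ j, j ≠ i ∧ R i j) :
    ∃ t : ℕ, A.card ≤ (2 * Δ + 2) * t ∧ ∃ p q : Fin t → Fin n,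
      StrictMono p ∧ Function.Injective q ∧ (∀ k k', p k ≠ q k') ∧ ∀ k, R (p k) (q k) := by
  -- a maximum admissible family `M` of index pairs: off-diagonal `R`-edges, pairwise vertex-disjoint
  obtain ⟨M, hM, hmax⟩ := (Finset.univ.filter fun M : Finset (Fin n × Fin n) =>
    (∀ e ∈ M, e.1 ≠ e.2 ∧ R e.1 e.2) ∧ ∀ e ∈ M, ∀ e' ∈ M, e ≠ e' →
      e.1 ≠ e'.1 ∧ e.1 ≠ e'.2 ∧ e.2 ≠ e'.1 ∧ e.2 ≠ e'.2).exists_max_image Finset.card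
    ⟨∅, Finset.mem_filter.2 ⟨Finset.mem_univ _, by simp⟩⟩
  obtain ⟨-, hM1, hM2⟩ := Finset.mem_filter.1 hM
  set V : Finset (Fin n) := M.image Prod.fst ∪ M.image Prod.snd with hV
  have hnotV : ∀ x, x ∉ V → ∀ e ∈ M, e.1 ≠ x ∧ e.2 ≠ x := fun x hx e he => by
    simp only [hV, Finset.mem_union, Finset.mem_image, not_or, not_exists, not_and] at hx
    exact ⟨hx.1 e he, hx.2 e he⟩
  -- maximality: every off-diagonal edge meets `V`
  have hmeet : ∀ i j, i ≠ j → R i j → i ∈ V ∨ j ∈ V := by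
    intro i j hij hR
    by_contra h
    obtain ⟨hi, hj⟩ := (not_or.1 h).imp (hnotV i) (hnotV j)
    have hins := hmax (insert (i, j) M) (Finset.mem_filter.2 ⟨Finset.mem_univ _, ?_, ?_⟩)
    · rw [Finset.card_insert_of_notMem fun h' => (hi _ h').1 rfl] at hins
      omega
    · exact (Finset.forall_mem_insert _ _ _).2 ⟨⟨hij, hR⟩, hM1⟩
    · intro e he e' he' hne
      rcases Finset.mem_insert.1 he with rfl | he <;> rcases Finset.mem_insert.1 he' with rfl | he'
      · exact absurd rfl hne
      · exact ⟨(hi e' he').1.symm, (hi e' he').2.symm, (hj e' he').1.symm, (hj e' he').2.symm⟩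
      · exact ⟨(hi e he).1, (hj e he).1, (hi e he).2, (hj e he).2⟩
      · exact hM2 e he e' he' hne
  have hcardP : (M.image Prod.fst).card = M.card :=
    Finset.card_image_of_injOn fun e he e' he' h => by_contra fun hne => (hM2 e he e' he' hne).1 h
  refine ⟨M.card, ?_, ?_⟩
  -- counting: `A ⊆ V ∪ ⋃_{w ∈ V} N(w)` and `card V ≤ 2 card M`
  · calc A.card ≤ (V ∪ V.biUnion fun w => Finset.univ.filter fun j => j ≠ w ∧ R w j).card := by
          refine Finset.card_le_card fun i hi => ?_
          obtain ⟨j, hji, hR⟩ := hA i hi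
          rcases hmeet i j hji.symm hR with h | h
          · exact Finset.mem_union_left _ h
          · exact Finset.mem_union_right _ (Finset.mem_biUnion.2
              ⟨j, h, Finset.mem_filter.2 ⟨Finset.mem_univ _, hji.symm, hsymm _ _ hR⟩⟩)
      _ ≤ V.card + ∑ w ∈ V, (Finset.univ.filter fun j => j ≠ w ∧ R w j).card :=
          (Finset.card_union_le _ _).trans (by gcongr; exact Finset.card_biUnion_le)
      _ ≤ V.card + ∑ _w ∈ V, Δ := by
          gcongr with w
          exact hdeg w _ fun j hj => (Finset.mem_filter.1 hj).2
      _ ≤ (2 * Δ + 2) * M.card := by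
          have : V.card ≤ M.card + M.card :=
            (Finset.card_union_le _ _).trans (Nat.add_le_add hcardP.le Finset.card_image_le)
          rw [Finset.sum_const, smul_eq_mul]
          nlinarith
  -- enumerate the first components increasingly and read off the partners
  · have hpmem : ∀ k : Fin M.card, ∃ e ∈ M, e.1 = (M.image Prod.fst).orderEmbOfFin hcardP k :=
      fun k => Finset.mem_image.1 (Finset.orderEmbOfFin_mem _ hcardP k)
    choose e he he1 using hpmem
    have hpmono := ((M.image Prod.fst).orderEmbOfFin hcardP).strictMono
    refine ⟨_, fun k => (e k).2, hpmono, fun k k' h => ?_, fun k k' => ?_, fun k => ?_⟩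
    · have hee : e k = e k' := by_contra fun hne => (hM2 _ (he k) _ (he k') hne).2.2.2 h
      exact hpmono.injective (by rw [← he1 k, ← he1 k', hee])
    · by_cases hee : e k = e k'
      · rw [← he1 k, hee]; exact (hM1 _ (he k')).1
      · rw [← he1 k]; exact (hM2 _ (he k) _ (he k') hee).2.1
    · rw [← he1 k]; exact (hM1 _ (he k)).2

/-- **Counting ordered families of pairs.** Pairs `(p, q)` of maps `Fin m → Fin n` with `p` strictly increasing
number at most `C(n, m) · n ^ m`: a strictly increasing map is determined by its range. [folklore] -/
theorem card_strictMono_pairs_le (n m : ℕ) :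
    (Finset.univ.filter fun pq : (Fin m → Fin n) × (Fin m → Fin n) =>
      StrictMono pq.1 ∧ Function.Injective pq.2 ∧ ∀ k k', pq.1 k ≠ pq.2 k').card ≤ n.choose m * n ^ m := by
  calc
    _ ≤ ((Finset.univ : Finset (Fin n)).powersetCard m ×ˢ (Finset.univ : Finset (Fin m → Fin n))).card := by
        refine Finset.card_le_card_of_injOn (fun pq => (Finset.univ.image pq.1, pq.2)) ?_ ?_
        · intro pq hpq
          have h := (Finset.mem_filter.1 (Finset.mem_coe.1 hpq)).2.1
          refine Finset.mem_coe.2 (Finset.mem_product.2 ⟨Finset.mem_powersetCard.2 ⟨Finset.subset_univ _, ?_⟩,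
            Finset.mem_univ _⟩)
          rw [Finset.card_image_of_injective _ h.injective, Finset.card_univ, Fintype.card_fin]
        · intro pq hpq pq' hpq' h
          simp only [Prod.mk.injEq] at h
          refine Prod.ext (((Finset.mem_filter.1 (Finset.mem_coe.1 hpq)).2.1.range_inj
            (Finset.mem_filter.1 (Finset.mem_coe.1 hpq')).2.1).1 ?_) h.2
          simpa only [Finset.coe_image, Finset.coe_univ, Set.image_univ] using
            congrArg (fun s : Finset (Fin n) => (s : Set (Fin n))) h.1
    _ = n.choose m * n ^ m := by simp [Finset.card_univ]

/-- **Summand estimate.** With `α n ≤ k ≤ 250 m` and `lam ≤ α e^{-250c} / (200·250·e·σ³)`: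
`e^{ck} (200 σ³ lam n)^m / m! ≤ 1` (by `m^m/m! ≤ e^m`, `n/m ≤ 250/α`, `e^{ck} ≤ e^{250cm}`). [folklore] -/
theorem exp_mul_mul_pow_div_factorial_le_one {c σ lam α nn : ℝ} {k m : ℕ} (hc : 0 ≤ c) (hσ : 0 < σ)
    (hlam : 0 < lam) (hα : 0 < α) (hnn : 0 < nn)
    (hlam₁ : lam ≤ α * Real.exp (-(250 * c)) / (200 * 250 * Real.exp 1 * σ ^ 3))
    (hk : α * nn ≤ k) (hkm : (k : ℝ) ≤ 250 * m) :
    Real.exp (c * k) * ((200 * σ ^ 3 * lam * nn) ^ m / m.factorial) ≤ 1 := by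
  have hkpos : (0 : ℝ) < k := (mul_pos hα hnn).trans_le hk
  have hm : (0 : ℝ) < m := by nlinarith
  -- `1/m! ≤ (e/m)^m`, the base `200σ³lam·e·n/m ≤ e^{-250c}`, the prefactor `e^{ck} ≤ (e^{250c})^m`
  have hfac : (1 : ℝ) / m.factorial ≤ (Real.exp 1 / m) ^ m := by
    rw [div_pow, div_le_div_iff₀ (by positivity) (by positivity), one_mul, ← Real.exp_nat_mul, mul_one]
    exact (div_le_iff₀ (by positivity)).1 (Real.pow_div_factorial_le_exp (m : ℝ) (Nat.cast_nonneg m) m)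
  have hnm : nn / m ≤ 250 / α := by rw [div_le_div_iff₀ hm hα]; nlinarith
  have h2 : 200 * σ ^ 3 * lam * nn * (Real.exp 1 / m) ≤ Real.exp (-(250 * c)) :=
    calc _ = 200 * σ ^ 3 * lam * Real.exp 1 * (nn / m) := by ring
      _ ≤ 200 * σ ^ 3 * (α * Real.exp (-(250 * c)) / (200 * 250 * Real.exp 1 * σ ^ 3)) *
            Real.exp 1 * (250 / α) := by gcongr
      _ = Real.exp (-(250 * c)) := by field_simp
  have h3 : Real.exp (c * k) ≤ Real.exp (250 * c) ^ m := by
    rw [← Real.exp_nat_mul, Real.exp_le_exp]; nlinarith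
  calc Real.exp (c * k) * ((200 * σ ^ 3 * lam * nn) ^ m / m.factorial)
      = Real.exp (c * k) * ((200 * σ ^ 3 * lam * nn) ^ m * (1 / m.factorial)) := by ring
    _ ≤ Real.exp (250 * c) ^ m * ((200 * σ ^ 3 * lam * nn) ^ m * (Real.exp 1 / m) ^ m) := by gcongr
    _ = (Real.exp (250 * c) * (200 * σ ^ 3 * lam * nn * (Real.exp 1 / m))) ^ m := by ring
    _ ≤ (Real.exp (250 * c) * Real.exp (-(250 * c))) ^ m := by gcongr
    _ = 1 := by rw [← Real.exp_add, add_neg_cancel, Real.exp_zero, one_pow]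

/-- **Final comparison.** For `ψ > 0`, `nn ≥ 1`, `ψ² nn ≥ 16` and `x ≤ ψ nn / 2`: `eˣ + (nn + 1) ≤ e^{ψ nn}`
(`e^y ≥ 1 + y + y²/2` with `y = ψ nn / 2`, `y² ≥ 4 nn`). [folklore] -/
theorem exp_add_le_exp_of_le_half {ψ nn x : ℝ} (hψ : 0 < ψ) (hnn : 1 ≤ nn) (h16 : 16 ≤ ψ ^ 2 * nn)
    (hx : x ≤ ψ * nn / 2) : Real.exp x + (nn + 1) ≤ Real.exp (ψ * nn) := by
  have hy2 : 4 * nn ≤ (ψ * nn / 2) ^ 2 := by nlinarith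
  have hq := Real.quadratic_le_exp_of_nonneg (show 0 ≤ ψ * nn / 2 by positivity)
  have he1 : nn + 2 ≤ Real.exp (ψ * nn / 2) := by nlinarith
  have hxle := Real.exp_le_exp.2 hx
  rw [show Real.exp (ψ * nn) = Real.exp (ψ * nn / 2) * Real.exp (ψ * nn / 2) by rw [← Real.exp_add]; ring_nf]
  nlinarith [Real.exp_pos (ψ * nn / 2), Real.add_one_le_exp (ψ * nn / 2)]

/-- **Tail-sum bound for an exponential moment.** For a probability measure `μ`, a count `S ≤ n` with
measurable super-level sets, `c ≥ 0` and a threshold `T`: if `e^{ck} μ{S ≥ k} ≤ 1` for every integer level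
`k ∈ [T, n]`, then `∫ e^{cS} dμ ≤ e^{cT} + (n + 1)` (integrate `e^{cS} ≤ e^{cT} + ∑_{T ≤ k ≤ n} e^{ck} 1{S ≥ k}`).
[folklore] -/
theorem lintegral_exp_mul_count_le {X : Type*} [MeasurableSpace X] (μ : Measure X) [IsProbabilityMeasure μ]
    (S : X → ℕ) {n : ℕ} (hSn : ∀ x, S x ≤ n) (hSm : ∀ k : ℕ, MeasurableSet {x | k ≤ S x}) {c T : ℝ}
    (hc : 0 ≤ c) (hk : ∀ k : ℕ, T ≤ k → k ≤ n → ENNReal.ofReal (Real.exp (c * k)) * μ {x | k ≤ S x} ≤ 1) :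
    ∫⁻ x, ENNReal.ofReal (Real.exp (c * (S x : ℝ))) ∂μ ≤ ENNReal.ofReal (Real.exp (c * T)) + ((n : ℝ≥0∞) + 1) := by
  set g : ℕ → X → ℝ≥0∞ := fun k x => ENNReal.ofReal (Real.exp (c * k)) * {x | k ≤ S x}.indicator 1 x with hg
  have hgm : ∀ k, Measurable (g k) := fun k => measurable_const.mul (measurable_one.indicator (hSm k))
  have hpt : ∀ x, ENNReal.ofReal (Real.exp (c * (S x : ℝ))) ≤
      ENNReal.ofReal (Real.exp (c * T)) + ∑ k ∈ Finset.Icc ⌈T⌉₊ n, g k x := by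
    intro x
    by_cases hx : (S x : ℝ) < T
    · exact le_add_right (ENNReal.ofReal_le_ofReal (Real.exp_le_exp.2 (mul_le_mul_of_nonneg_left hx.le hc)))
    · have hmem : S x ∈ Finset.Icc ⌈T⌉₊ n := Finset.mem_Icc.2 ⟨Nat.ceil_le.2 (not_lt.1 hx), hSn x⟩
      refine le_add_left ((le_of_eq ?_).trans (Finset.single_le_sum (fun k _ => zero_le) hmem))
      rw [hg]; dsimp only
      rw [Set.indicator_of_mem (show x ∈ {y | S x ≤ S y} from le_refl (S x)), Pi.one_apply, mul_one]
  calc ∫⁻ x, ENNReal.ofReal (Real.exp (c * (S x : ℝ))) ∂μ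
      ≤ ∫⁻ x, (ENNReal.ofReal (Real.exp (c * T)) + ∑ k ∈ Finset.Icc ⌈T⌉₊ n, g k x) ∂μ := lintegral_mono hpt
    _ = ENNReal.ofReal (Real.exp (c * T)) + ∑ k ∈ Finset.Icc ⌈T⌉₊ n, ∫⁻ x, g k x ∂μ := by
        rw [lintegral_add_left measurable_const, lintegral_const, measure_univ, mul_one,
          lintegral_finsetSum _ fun k _ => hgm k]
    _ ≤ ENNReal.ofReal (Real.exp (c * T)) + ∑ _k ∈ Finset.Icc ⌈T⌉₊ n, (1 : ℝ≥0∞) := by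
        gcongr with k hk'
        rw [hg]; dsimp only
        rw [lintegral_const_mul _ (measurable_one.indicator (hSm k)), lintegral_indicator_one (hSm k)]
        exact hk k ((Nat.le_ceil T).trans (by exact_mod_cast (Finset.mem_Icc.1 hk').1)) (Finset.mem_Icc.1 hk').2
    _ ≤ ENNReal.ofReal (Real.exp (c * T)) + ((n : ℝ≥0∞) + 1) := by
        rw [Finset.sum_const, nsmul_one, Nat.card_Icc]
        gcongr
        exact_mod_cast Nat.sub_le _ _

/-- **Measurable super-level sets of a count.** If the events `P · i` are measurable, so is
`{x | k ≤ #{i | P x i}}` (the count is a finite sum of indicators). [folklore] -/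
theorem measurableSet_le_card_filter {X ι : Type*} [MeasurableSpace X] [Fintype ι] (P : X → ι → Prop)
    [∀ x, DecidablePred (P x)] (hP : ∀ i, MeasurableSet {x | P x i}) (k : ℕ) :
    MeasurableSet {x | k ≤ (Finset.univ.filter fun i => P x i).card} := by
  have hS : Measurable fun x => ((Finset.univ.filter fun i => P x i).card : ℝ) := by
    have h : (fun x => ((Finset.univ.filter fun i => P x i).card : ℝ)) =
        fun x => ∑ i, if P x i then (1 : ℝ) else 0 := by
      funext x; rw [Finset.card_filter]; push_cast; rfl
    rw [h]
    exact Finset.measurable_sum _ fun i _ => Measurable.ite (hP i) measurable_const measurable_const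
  rw [show {x | k ≤ (Finset.univ.filter fun i => P x i).card} =
      {x | (k : ℝ) ≤ ((Finset.univ.filter fun i => P x i).card : ℝ)} by ext x; simp only [mem_setOf_eq, Nat.cast_le]]
  exact measurableSet_le measurable_const hS

/-- **Degree bound.** In a hard-sphere configuration (pairwise minimal-image distances `≥ ε`), the spheres
`j ≠ i` within distance `ε(1 + lam) ≤ 2ε` of sphere `i` are at most `124`: together with `i` they are
`ε`-separated points within `2ε` of `x_i`, at most `(2·2ε/ε + 1)³ = 125` by packing. [folklore] -/
theorem closeNeighbours_card_le
    (hpack : ∀ {n : ℕ} {ε ρ : ℝ}, 0 < ε → 0 ≤ ρ → ∀ (x₀ : T3) (x : Fin n → T3) (I : Finset (Fin n)),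
      (∀ i ∈ I, ∀ j ∈ I, i ≠ j → ε ≤ Torus.euclidDist (x i) (x j)) →
      (∀ i ∈ I, Torus.euclidDist (x i) x₀ ≤ ρ) → (I.card : ℝ) ≤ (2 * ρ / ε + 1) ^ 3)
    {n : ℕ} {ε lam : ℝ} (hε : 0 < ε) (hlam1 : lam ≤ 1) {z : Config n (Fin 3) T3}
    (hz : z ∈ hardSphereDomain (Torus.geometry (Fin 3)) n ε) (i : Fin n) (B : Finset (Fin n))
    (hB : ∀ j ∈ B, j ≠ i ∧ Torus.euclidDist (z i).1 (z j).1 ≤ ε * (1 + lam)) : B.card ≤ 124 := by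
  have hiB : i ∉ B := fun h => (hB i h).1 rfl
  have h1 : ((insert i B).card : ℝ) ≤ (2 * (2 * ε) / ε + 1) ^ 3 := by
    refine hpack hε (by positivity) (z i).1 (fun j => (z j).1) (insert i B) (fun j _ j' _ hjj' => ?_) ?_
    · simpa only [Torus.norm_geometry_sepVec] using (mem_hardSphereDomain.1 hz) j j' hjj'
    · intro j hj
      rcases Finset.mem_insert.1 hj with rfl | hj
      · show Torus.euclidDist (z j).1 (z j).1 ≤ 2 * ε; rw [Torus.euclidDist_self]; positivity
      · show Torus.euclidDist (z j).1 (z i).1 ≤ 2 * ε; rw [Torus.euclidDist_comm]; nlinarith [(hB j hj).2]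
  rw [mul_div_assoc, mul_div_cancel_right₀ _ hε.ne', Finset.card_insert_of_notMem hiB] at h1
  norm_num at h1
  have h3 : B.card + 1 ≤ 125 := by exact_mod_cast h1
  omega

/-- **Union bound over ordered families of disjoint close pairs.** Under the homogeneous Gibbs law, if
`k ≤ 250 t → m ≤ t` for all `t`, then `G_N{S ≥ k} ≤ C(N+1, m) (N+1)^m (200σ³lam/(N+1))^m ≤ (200σ³lam(N+1))^m/m!`:
a.e. configuration is a hard-sphere configuration, in which `S ≥ k` forces `m` disjoint close pairs `(p k', q k')`
with `p` increasing (degree bound + matching lemma), each family being close with probability `≤ (200σ³lam/(N+1))^m`.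
[folklore] -/
theorem measure_le_closeCount_le
    (hpairs : ∀ (a θ : ℝ) (u₀ : V3), 0 < a → 0 < θ → ∀ σ : ℝ, 0 < σ → σ ≤ 1 / 4 →
      ∀ (N : ℕ) (Φ : HardSphereFlow (Torus.geometry (Fin 3)) (hsDiameter σ N) (N + 1))
      (m : ℕ) (p q : Fin m → Fin (N + 1)), Function.Injective p → Function.Injective q →
      (∀ k k', p k ≠ q k') → ∀ lam : ℝ, 0 < lam → lam ≤ 1 →
      localGibbsLaw σ (fun _ => a) (fun _ => u₀) (fun _ => θ) N Φ
          {z | ∀ k, Torus.euclidDist (z (p k)).1 (z (q k)).1 ≤ hsDiameter σ N * (1 + lam)} ≤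
        ENNReal.ofReal ((200 * σ ^ 3 * lam / (N + 1)) ^ m))
    (hpack : ∀ {n : ℕ} {ε ρ : ℝ}, 0 < ε → 0 ≤ ρ → ∀ (x₀ : T3) (x : Fin n → T3) (I : Finset (Fin n)),
      (∀ i ∈ I, ∀ j ∈ I, i ≠ j → ε ≤ Torus.euclidDist (x i) (x j)) →
      (∀ i ∈ I, Torus.euclidDist (x i) x₀ ≤ ρ) → (I.card : ℝ) ≤ (2 * ρ / ε + 1) ^ 3)
    {a θ : ℝ} (u₀ : V3) (ha : 0 < a) (hθ : 0 < θ) {σ : ℝ} (hσ : 0 < σ) (hσ4 : σ ≤ 1 / 4)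
    {lam : ℝ} (hlam : 0 < lam) (hlam1 : lam ≤ 1) (N : ℕ)
    (Φ : HardSphereFlow (Torus.geometry (Fin 3)) (hsDiameter σ N) (N + 1)) (k m : ℕ)
    (hm : ∀ t : ℕ, k ≤ 250 * t → m ≤ t) :
    localGibbsLaw σ (fun _ => a) (fun _ => u₀) (fun _ => θ) N Φ
        {z | k ≤ (Finset.univ.filter fun i : Fin (N + 1) => ∃ j : Fin (N + 1), j ≠ i ∧
          Torus.euclidDist (z i).1 (z j).1 ≤ hsDiameter σ N * (1 + lam)).card} ≤
      ENNReal.ofReal ((200 * σ ^ 3 * lam * (N + 1)) ^ m / m.factorial) := by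
  set r : ℝ := hsDiameter σ N * (1 + lam) with hr
  set G := localGibbsLaw σ (fun _ => a) (fun _ => u₀) (fun _ => θ) N Φ with hG
  -- the admissible index families and their events
  set F : Finset ((Fin m → Fin (N + 1)) × (Fin m → Fin (N + 1))) := Finset.univ.filter fun pq =>
    StrictMono pq.1 ∧ Function.Injective pq.2 ∧ ∀ k k', pq.1 k ≠ pq.2 k' with hF
  set C : (Fin m → Fin (N + 1)) × (Fin m → Fin (N + 1)) → Set (Config (N + 1) (Fin 3) T3) :=
    fun pq => {z | ∀ k, Torus.euclidDist (z (pq.1 k)).1 (z (pq.2 k)).1 ≤ r} with hC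
  -- a.e. configuration is a hard-sphere configuration; there `S ≥ k` forces a family in `F` to be close
  have hgood : ∀ᵐ z ∂G, z ∈ Φ.good :=
    (withDensity_absolutelyContinuous _ _ : G ≪ liouville (Torus.geometry (Fin 3)) (N + 1) (hsDiameter σ N)).ae_le
      Φ.ae_mem_good
  have hcover : ∀ᵐ z ∂G, z ∈ {z : Config (N + 1) (Fin 3) T3 | k ≤ (Finset.univ.filter fun i : Fin (N + 1) =>
      ∃ j : Fin (N + 1), j ≠ i ∧ Torus.euclidDist (z i).1 (z j).1 ≤ r).card} → z ∈ ⋃ pq ∈ F, C pq := by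
    refine hgood.mono fun z hz hzk => ?_
    obtain ⟨t, ht, p, q, hp, hq, hpq, hR⟩ := exists_strictMono_matching
      (fun i j : Fin (N + 1) => Torus.euclidDist (z i).1 (z j).1 ≤ r) (fun i j h => by rwa [Torus.euclidDist_comm])
      (fun i B hB => closeNeighbours_card_le hpack (Literature.MathematicalPhysics.KineticTheory.hsDiameter_pos hσ N)
        hlam1 (Φ.good_subset hz) i B hB)
      (Finset.univ.filter fun i : Fin (N + 1) => ∃ j : Fin (N + 1), j ≠ i ∧ Torus.euclidDist (z i).1 (z j).1 ≤ r)
      fun i hi => (Finset.mem_filter.1 hi).2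
    have hmt : m ≤ t := hm t (by rw [Set.mem_setOf_eq] at hzk; omega)
    refine Set.mem_iUnion₂.2 ⟨(p ∘ Fin.castLE hmt, q ∘ Fin.castLE hmt), ?_, fun k => hR _⟩
    rw [hF, Finset.mem_filter]
    exact ⟨Finset.mem_univ _, hp.comp (Fin.strictMono_castLE hmt), hq.comp (Fin.castLE_injective hmt),
      fun k k' => hpq _ _⟩
  have hNpos : (0 : ℝ) < N + 1 := by positivity
  calc G _ ≤ G (⋃ pq ∈ F, C pq) := measure_mono_ae hcover
    _ ≤ ∑ pq ∈ F, G (C pq) := measure_biUnion_finset_le F C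
    _ ≤ ∑ pq ∈ F, ENNReal.ofReal ((200 * σ ^ 3 * lam / (N + 1)) ^ m) := by
        refine Finset.sum_le_sum fun pq hpq => ?_
        rw [hF, Finset.mem_filter] at hpq
        exact hpairs a θ u₀ ha hθ σ hσ hσ4 N Φ m pq.1 pq.2 hpq.2.1.injective hpq.2.2.1 hpq.2.2.2 lam hlam hlam1
    _ ≤ ENNReal.ofReal ((N + 1 : ℝ) ^ m / m.factorial * (N + 1 : ℝ) ^ m) *
          ENNReal.ofReal ((200 * σ ^ 3 * lam / (N + 1)) ^ m) := by
        rw [Finset.sum_const, nsmul_eq_mul, ← ENNReal.ofReal_natCast]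
        gcongr
        calc (F.card : ℝ) ≤ (((N + 1).choose m * (N + 1) ^ m : ℕ) : ℝ) := by
              exact_mod_cast card_strictMono_pairs_le (N + 1) m
          _ ≤ (N + 1 : ℝ) ^ m / m.factorial * (N + 1) ^ m := by
              push_cast
              gcongr
              exact_mod_cast Nat.choose_le_pow_div (α := ℝ) m (N + 1)
    _ = ENNReal.ofReal ((200 * σ ^ 3 * lam * (N + 1)) ^ m / m.factorial) := by
        rw [← ENNReal.ofReal_mul (by positivity), div_pow, mul_pow _ ((N : ℝ) + 1)]
        congr 1
        field_simp

/-- **Static close-pair pressure from the disjoint-pairs bound and packing** (`snp_static` with its two inputs as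
hypotheses): a close-pair graph with `k` non-isolated vertices and maximal degree `≤ 124` (packing: the neighbours of
a sphere within `2ε_N` are `ε_N`-separated) has `≥ k/250` disjoint edges; union bound over the `≤ C(N+1, m)(N+1)^m`
ordered families of `m` disjoint pairs; tail sum `E e^{cS} ≤ e^{cα(N+1)} + (N+2) ≤ e^{ψ(N+1)}` once
`200eσ³lam · 250e^{250c}/α ≤ 1`, `α = ψ/(2(c+1))`, `N + 1 ≥ 16/ψ²`. [folklore] -/
theorem snp_static_of_pairsBound : ∀ (hpairs : ∀ (a θ : ℝ) (u₀ : V3), 0 < a → 0 < θ → ∀ σ : ℝ, 0 < σ → σ ≤ 1 / 4 →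
      ∀ (N : ℕ) (Φ : HardSphereFlow (Torus.geometry (Fin 3)) (hsDiameter σ N) (N + 1))
      (m : ℕ) (p q : Fin m → Fin (N + 1)), Function.Injective p → Function.Injective q →
      (∀ k k', p k ≠ q k') → ∀ lam : ℝ, 0 < lam → lam ≤ 1 →
      localGibbsLaw σ (fun _ => a) (fun _ => u₀) (fun _ => θ) N Φ
          {z | ∀ k, Torus.euclidDist (z (p k)).1 (z (q k)).1 ≤ hsDiameter σ N * (1 + lam)} ≤
        ENNReal.ofReal ((200 * σ ^ 3 * lam / (N + 1)) ^ m))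
    (hpack : ∀ {n : ℕ} {ε ρ : ℝ}, 0 < ε → 0 ≤ ρ → ∀ (x₀ : T3) (x : Fin n → T3) (I : Finset (Fin n)),
      (∀ i ∈ I, ∀ j ∈ I, i ≠ j → ε ≤ Torus.euclidDist (x i) (x j)) →
      (∀ i ∈ I, Torus.euclidDist (x i) x₀ ≤ ρ) → (I.card : ℝ) ≤ (2 * ρ / ε + 1) ^ 3)
    (a θ : ℝ) (u₀ : V3) (ha : 0 < a) (hθ : 0 < θ) (σ : ℝ) (hσ : 0 < σ) (hσ4 : σ ≤ 1 / 4)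
    (c ψ : ℝ) (hc : 0 ≤ c) (hψ : 0 < ψ),
    ∃ lam₀ : ℝ, 0 < lam₀ ∧ ∀ lam : ℝ, 0 < lam → lam ≤ lam₀ → ∃ N₀ : ℕ, ∀ N : ℕ, N₀ ≤ N →
      ∀ Φ : HardSphereFlow (Torus.geometry (Fin 3)) (hsDiameter σ N) (N + 1),
      ∫⁻ z, ENNReal.ofReal (Real.exp (c * ((Finset.univ.filter fun i : Fin (N + 1) =>
          ∃ j : Fin (N + 1), j ≠ i ∧
            Torus.euclidDist (z i).1 (z j).1 ≤ hsDiameter σ N * (1 + lam)).card : ℝ)))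
        ∂(localGibbsLaw σ (fun _ => a) (fun _ => u₀) (fun _ => θ) N Φ)
      ≤ ENNReal.ofReal (Real.exp (ψ * (N + 1))) := by
  intro hpairs hpack a θ u₀ ha hθ σ hσ hσ4 c ψ hc hψ
  -- constants `α = ψ/(2(c+1))`, `lam₀ = min 1 (α e^{-250c}/(200·250·e·σ³))`, `N₀ = ⌈16/ψ²⌉`
  set α : ℝ := ψ / (2 * (c + 1)) with hα
  have hαpos : 0 < α := by positivity
  have hlam₁pos : 0 < α * Real.exp (-(250 * c)) / (200 * 250 * Real.exp 1 * σ ^ 3) := by positivity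
  refine ⟨min 1 (α * Real.exp (-(250 * c)) / (200 * 250 * Real.exp 1 * σ ^ 3)), lt_min one_pos hlam₁pos,
    fun lam hlam hlamle => ⟨⌈16 / ψ ^ 2⌉₊, fun N hN Φ => ?_⟩⟩
  have hlam1 : lam ≤ 1 := hlamle.trans (min_le_left _ _)
  haveI : IsProbabilityMeasure (localGibbsLaw σ (fun _ => a) (fun _ => u₀) (fun _ => θ) N Φ) :=
    Literature.MathematicalPhysics.KineticTheory.isProbabilityMeasure_localGibbsLaw continuous_const
      continuous_const continuous_const (fun _ => ha) (fun _ => hθ) (hσ4.trans (by norm_num)) N Φ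
  have hNpos : (0 : ℝ) < N + 1 := by positivity
  -- measurability of the close-pair events
  have hE : ∀ i : Fin (N + 1), MeasurableSet {z : Config (N + 1) (Fin 3) T3 | ∃ j : Fin (N + 1), j ≠ i ∧
      Torus.euclidDist (z i).1 (z j).1 ≤ hsDiameter σ N * (1 + lam)} := fun i => by
    have hpos : Measurable fun z : Config (N + 1) (Fin 3) T3 => fun i => (z i).1 :=
      measurable_pi_lambda _ fun i => (measurable_pi_apply i).fst
    rw [show {z : Config (N + 1) (Fin 3) T3 | ∃ j : Fin (N + 1), j ≠ i ∧
        Torus.euclidDist (z i).1 (z j).1 ≤ hsDiameter σ N * (1 + lam)} = ⋃ j : Fin (N + 1),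
        {z | j ≠ i ∧ Torus.euclidDist (z i).1 (z j).1 ≤ hsDiameter σ N * (1 + lam)} by ext z; simp]
    refine MeasurableSet.iUnion fun j => ?_
    by_cases hji : j = i
    · simp [hji]
    · have hd := (Literature.MathematicalPhysics.KineticTheory.continuous_euclidDist_apply
        (d := Fin 3) i j).measurable.comp hpos
      simpa only [hji, ne_eq, not_false_eq_true, true_and, Function.comp_apply] using
        measurableSet_le hd measurable_const
  -- tail sum with threshold `T = α (N + 1)`; the summand at level `k` uses `m = ⌈k/250⌉` disjoint pairs
  refine (lintegral_exp_mul_count_le (localGibbsLaw σ (fun _ => a) (fun _ => u₀) (fun _ => θ) N Φ)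
    (fun z : Config (N + 1) (Fin 3) T3 => (Finset.univ.filter fun i : Fin (N + 1) => ∃ j : Fin (N + 1), j ≠ i ∧
      Torus.euclidDist (z i).1 (z j).1 ≤ hsDiameter σ N * (1 + lam)).card) (n := N + 1)
    (fun z => (Finset.card_filter_le _ _).trans (by simp)) (measurableSet_le_card_filter _ hE) hc
    (T := α * (N + 1)) fun k hk1 _ => ?_).trans ?_
  · have hkm : (k : ℝ) ≤ 250 * ⌈(k : ℝ) / 250⌉₊ := by
      have h := Nat.le_ceil ((k : ℝ) / 250)
      rw [div_le_iff₀ (by norm_num)] at h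
      linarith
    have hP := measure_le_closeCount_le hpairs hpack u₀ ha hθ hσ hσ4 hlam hlam1 N Φ k ⌈(k : ℝ) / 250⌉₊
      fun t ht => Nat.ceil_le.2 ((div_le_iff₀ (by norm_num)).2 (by exact_mod_cast ht.trans_eq (mul_comm _ _)))
    calc _ ≤ ENNReal.ofReal (Real.exp (c * k)) * ENNReal.ofReal ((200 * σ ^ 3 * lam * (N + 1)) ^ ⌈(k : ℝ) / 250⌉₊ /
            (⌈(k : ℝ) / 250⌉₊).factorial) := by gcongr
      _ ≤ ENNReal.ofReal 1 := by
          rw [← ENNReal.ofReal_mul (Real.exp_pos _).le]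
          exact ENNReal.ofReal_le_ofReal (exp_mul_mul_pow_div_factorial_le_one hc hσ hlam hαpos hNpos
            (hlamle.trans (min_le_right _ _)) hk1 hkm)
      _ = 1 := ENNReal.ofReal_one
  -- `e^{cα(N+1)} + (N + 2) ≤ e^{ψ(N+1)}`
  · have h16 : 16 ≤ ψ ^ 2 * (N + 1 : ℝ) := by
      have h1 := (div_le_iff₀ (by positivity)).1 ((Nat.le_ceil (16 / ψ ^ 2)).trans ((Nat.cast_le (α := ℝ)).2 hN))
      nlinarith [sq_nonneg ψ]
    have hcα : c * (α * (N + 1)) ≤ ψ * (N + 1) / 2 := by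
      have h1 : c * (ψ / (2 * (c + 1))) ≤ ψ / 2 := by
        rw [mul_div_assoc', div_le_div_iff₀ (by positivity) (by positivity)]
        nlinarith
      nlinarith
    calc ENNReal.ofReal (Real.exp (c * (α * (N + 1)))) + (((N + 1 : ℕ) : ℝ≥0∞) + 1)
        = ENNReal.ofReal (Real.exp (c * (α * (N + 1))) + ((N + 1 : ℝ) + 1)) := by
          rw [ENNReal.ofReal_add (Real.exp_pos _).le (by positivity), ← ENNReal.ofReal_natCast, Nat.cast_add,
            Nat.cast_one, ← ENNReal.ofReal_one, ← ENNReal.ofReal_add (by positivity) zero_le_one]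
      _ ≤ ENNReal.ofReal (Real.exp (ψ * (N + 1))) :=
          ENNReal.ofReal_le_ofReal (exp_add_le_exp_of_le_half hψ (by linarith) h16 hcα)

end Summit.AtomisticToContinuum.HydrodynamicLimit.Theorems.ShotNoisePressure

end
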